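import Summits.BirchSwinnertonDyer.BirchSwinnertonDyer.Theses.PrintCf2RubinValueTwo
import Summits.BirchSwinnertonDyer.BirchSwinnertonDyer.Theorems.PrintCf2SplitBadTwoStrictDefectAssemblyOfClasses
import Summits.BirchSwinnertonDyer.BirchSwinnertonDyer.Theorems.PrintCf2SplitBadTwoStrictDefectClassOne
import Summits.BirchSwinnertonDyer.BirchSwinnertonDyer.Theorems.PrintCf2SplitBadTwoStrictDefectClassThreeOfFrame
import HarnessLib

/-!
# Route C `PrintCf2RubinValueTwo`, crux item stmt-BirchSwinnertonDyer-24036 `StrictDefectAtVbarTwo` (S3d of LEAD skeleton v13.1, VERBATIM) HOLDS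

Cell `bsd-print-cf2`, width seat `bsd-line-cf2-p1-w6` g5 (S3d assembly lane); `--workitem stmt-BirchSwinnertonDyer-24036` (by-name closer: the theorem's type is
the route decl). HONEST FRAMING: closes the route-C crux 24036 (= the LEAD's stub S3d) and nothing else — the route's remaining open cruxes (24033/24086 S3a-quad,
24034 S2′-v11, 24037 S3n′) are untouched; no summit statement is proved by this seat; BSD is not proved by any of this. No definition, no named fact, no `sorry`.

THE COMPOSITION (tree theorems only, by name): `StrictDefect.strictDefectAtVbar_two_of_classes` (p696075, the case split over `[d]₂`, class (ii) p693541 inlined)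
applied to -w3 g12's class-(iii) instances `StrictDefect.strictDefectAtVbar_two_of_frame_three` (`e = 2`) and `…_of_frame_even_seven` (`e = 1`) and -w8 g4's
class-(i) instance `LineDoubleCoset.strictDefectAtVbar_two_of_frame_classOne` (`e = 0`); the item's text is definitionally that statement (`unfold`).

presearch: not applicable (by-name composition of tree theorems). beyond-print theorem: no.

References: [GreenbergVatsal2000] §2 pp. 17–22; [Agboola2007] §3 Prop. 3.2, Thm. 3.1.
-/

noncomputable section

-- the summit namespace `Summit.BirchSwinnertonDyer.BirchSwinnertonDyer` repeats the problem name by design (D-0017)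
set_option linter.dupNamespace false
set_option autoImplicit false

namespace Summit.BirchSwinnertonDyer.BirchSwinnertonDyer.Theorems.PrintCf2.StrictDefectAtVbarTwoHolds

open Summit.BirchSwinnertonDyer.BirchSwinnertonDyer.Theorems.PrintCf2

/-- **Route-C crux `StrictDefectAtVbarTwo` (stmt-BirchSwinnertonDyer-24036) holds**: S3d's class table `e_δ = 2` on `d ≡ 3 (8)`, `1` on `d ≡ 14 (16)`, `0` on
`d ≡ 7 (8)`, `d ≡ 2, 6, 10 (16)` — the item's text verbatim, by the case split p696075 over the four per-class tree theorems.
[cite: GreenbergVatsal2000, §2 Cor. 2.3 and Prop. 2.4] [cite: Agboola2007, §3 Prop. 3.2 and Thm. 3.1] -/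
theorem strictDefectAtVbarTwo_holds :
    Summit.BirchSwinnertonDyer.BirchSwinnertonDyer.Theses.PrintCf2RubinValueTwo.StrictDefectAtVbarTwo := by
  unfold Summit.BirchSwinnertonDyer.BirchSwinnertonDyer.Theses.PrintCf2RubinValueTwo.StrictDefectAtVbarTwo
  exact StrictDefect.strictDefectAtVbar_two_of_classes StrictDefect.strictDefectAtVbar_two_of_frame_three
    StrictDefect.strictDefectAtVbar_two_of_frame_even_seven
    (fun d hd0 hsq hd4 hcl ↦ LineDoubleCoset.strictDefectAtVbar_two_of_frame_classOne d hd0 hsq hd4 hcl.1 hcl.2)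

end Summit.BirchSwinnertonDyer.BirchSwinnertonDyer.Theorems.PrintCf2.StrictDefectAtVbarTwoHolds

end
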